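import Literature.AnabelianGeometry.AbsoluteAnabelian.AbsTopIII.FrobeniusPictureMLFShiftLog
import Literature.AnabelianGeometry.AbsoluteAnabelian.AbsTopIII.FrobeniusPictureMLFShiftCores

/-!
# [AbsTopIII] Corollary 3.6 (v), third sentence — the glued homotopies of the master family are invariant
# under the translation of the first row

S. Mochizuki, *Topics in Absolute Anabelian Geometry III*, Cor. 3.6 (iii), (v) pp. 80–81 of the kurims
manuscript (`paper:url-5493eb38cbb7`; bib key `MochizukiAbsTopIII2015`).  Seat abc-iut-w6-d023 (row
«Cor36-SHIFT»; sequel of `FrobeniusPictureMLFShiftCores.lean` / `FrobeniusPictureMLFShiftLog.lean`).  On `𝒟`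
itself: the lifts to `𝒟_{≤3}` of translated paths are the translated lifts (`liftLogPath_shift_heq`), the
glued boundary set `GlueE = E_W ∪ E_log` of the master family (abc-iut-L4-t5,
`FrobeniusPictureMLFLogGlueBoundary.lean`) is stable under `LFVertex.shift m` in both directions
(`glueE_shift_iff`), and the glued homotopies `glueη` (`FrobeniusPictureMLFLogGlueFamilyEta.lean`: the
universal homotopies over `ℰ` on pairs into rows 4–6, the pushed-forward `𝔖_log` homotopies on pairs into
`𝒩`) are invariant: `glueη (shift γ₁, shift γ₂) ≍ glueη (γ₁, γ₂)` for every `𝔖_log` family `H₃`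
(`glueη_shift_heq`).  These are exactly the boundary-set and homotopy inputs of the generic Def. 3.5 (v)
constructor `OneMorphism.compatibleWithOfInvariant` (`DiagramShiftInvariance.lean`) for the nexus
self-equivalences `Φ_m` and the master family; the assembly with the bundled master family `glueFamily`
(abc-iut-w5-d053) is the one-line sequel.  Pure combinatorics / category theory over the typed data;
nothing here bears on [IUTchIII] Cor. 3.12; no side is taken on inter-universal Teichmüller theory.
-/

namespace Literature.AnabelianGeometry.AbsoluteAnabelian

open _root_.CategoryTheory _root_.Quiver

universe u

namespace LogFrobeniusData

open DiagramOfCategories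

/-! ### Lifting to `𝒟_{≤3}` commutes with the translation -/

/-- The row of a vertex is unchanged by the translation. [cite: MochizukiAbsTopIII2015, Corollary 3.6 (v) p.80] -/
theorem row_shiftObj (m : ℤ) : ∀ v : LFVertex, (LFVertex.shiftObj m v).row = v.row
  | .row1 _ => rfl
  | .nexus => rfl
  | .third => rfl
  | .fourth => rfl
  | .fifth => rfl
  | .sixth => rfl

/-- The lift of a translated vertex is the translated lift. [cite: MochizukiAbsTopIII2015, Corollary 3.6 (v) p.80] -/
theorem liftLogVertex_shiftObj (m : ℤ) : ∀ (v : LFVertex) (h : v.row ≤ 3) (h' : (LFVertex.shiftObj m v).row ≤ 3),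
    liftLogVertex.{u} (LFVertex.shiftObj m v) h' = (shiftLog.{u} m).obj (liftLogVertex.{u} v h)
  | .row1 _, _, _ => rfl
  | .nexus, _, _ => rfl
  | .third, _, _ => rfl
  | .fourth, h, _ => absurd h (by decide)
  | .fifth, h, _ => absurd h (by decide)
  | .sixth, h, _ => absurd h (by decide)

/-- The lift of a translated edge is the translated lift (heterogeneously). [cite: MochizukiAbsTopIII2015, Corollary 3.6 (v) p.80] -/
theorem liftLogEdge_shift_heq (m : ℤ) {b c : LFVertex} (e : b ⟶ c) (hc : c.row ≤ 3)
    (hc' : (LFVertex.shiftObj m c).row ≤ 3) :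
    HEq (liftLogEdge.{u} ((LFVertex.shift.{u} m).map e) hc') ((shiftLog.{u} m).map (liftLogEdge.{u} e hc)) := by
  have hb : b.row ≤ 3 := (LFVertex.row_le_of_hom e).trans hc
  revert e hc hc' hb
  cases b <;> cases c <;> intro e hc hc' hb <;>
    first
      | exact (PEmpty.elim e)
      | exact absurd hc (by decide)
      | exact absurd hb (by decide)
      | exact HEq.rfl

/-- **Lifting commutes with the translation**: the lift to `𝒟_{≤3}` of a translated path of `𝒟` (ending in
rows 1–3) is the translated lift (heterogeneously: the endpoints agree by `liftLogVertex_shiftObj`).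
[cite: MochizukiAbsTopIII2015, Corollary 3.6 (v) p.80] -/
theorem liftLogPath_shift_heq (m : ℤ) {a : LFVertex} : ∀ {b : LFVertex} (P : Path a b) (hb : b.row ≤ 3)
    (hb' : (LFVertex.shiftObj m b).row ≤ 3),
    HEq (liftLogPath.{u} ((LFVertex.shift.{u} m).mapPath P) hb')
      ((shiftLog.{u} m).mapPath (liftLogPath.{u} P hb)) := by
  intro b P
  induction P with
  | nil =>
    intro hb hb'
    rw [Prefunctor.mapPath_nil, liftLogPath_nil, liftLogPath_nil, Prefunctor.mapPath_nil]
    exact heq_path_nil (liftLogVertex_shiftObj m a hb hb')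
  | cons P e ih =>
    rename_i b c
    intro hc hc'
    have hb : b.row ≤ 3 := (LFVertex.row_le_of_hom e).trans hc
    have hb' : (LFVertex.shiftObj m b).row ≤ 3 := (row_shiftObj m b).symm ▸ hb
    rw [Prefunctor.mapPath_cons, liftLogPath_cons, liftLogPath_cons, Prefunctor.mapPath_cons]
    exact heq_path_cons (liftLogVertex_shiftObj m a _ _) (liftLogVertex_shiftObj m b hb hb')
      (liftLogVertex_shiftObj m c hc hc') (ih hb hb') (liftLogEdge_shift_heq m e hc hc')

variable (Δ : LogFrobeniusData.{u})

/-! ### The glued boundary set is stable under the translation -/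

/-- **`GlueE` is stable under the translation** (pairs through a core vertex go to pairs through the same core
vertex; `E_log` pairs go to `E_log` pairs, `saturation_logGen_shiftLog`).
[cite: MochizukiAbsTopIII2015, Corollary 3.6 (v) p.80] -/
theorem glueE_shift (m : ℤ) {a b : LFVertex} {P Q : Path a b} (h : Δ.GlueE P Q) :
    Δ.GlueE ((LFVertex.shift.{u} m).mapPath P) ((LFVertex.shift.{u} m).mapPath Q) := by
  cases h with
  | univ hu => exact GlueE.univ (univE_mapPath coreVertices (LFVertex.shift.{u} m) (coreVertices_shift m) hu)
  | log hs =>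
    exact GlueE.log (Saturation.of_heq (liftLogVertex_shiftObj m a _ _).symm rfl
      (liftLogPath_shift_heq m _ le_rfl le_rfl).symm (liftLogPath_shift_heq m _ le_rfl le_rfl).symm
      (Δ.saturation_logGen_shiftLog m hs))

/-- **`Φ_Γ⃗` induces a bijection between the boundary sets** (Def. 3.5 (v)) for the master family:
`GlueE(γ₁,γ₂) ↔ GlueE(shift γ₁, shift γ₂)`. [cite: MochizukiAbsTopIII2015, Corollary 3.6 (v) p.80] -/
theorem glueE_shift_iff (m : ℤ) {a b : LFVertex} (P Q : Path a b) :
    Δ.GlueE P Q ↔ Δ.GlueE ((LFVertex.shift.{u} m).mapPath P) ((LFVertex.shift.{u} m).mapPath Q) :=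
  HomotopyFamily.E_mapPath_iff_of_inverse (LFVertex.shift_comp_neg m) Δ.GlueE
    (fun _ _ _ _ h => Δ.glueE_shift m h) (fun _ _ _ _ h => Δ.glueE_shift (-m) h) P Q

/-! ### The glued homotopies are invariant under the translation -/

variable {Δ}

/-- The pushed-forward `𝔖_log` homotopies of a pair of lifts and of the translated lifts agree
(heterogeneously), for an `𝔖_log` family. [cite: MochizukiAbsTopIII2015, Corollary 3.6 (v) p.80] -/
theorem IsLogObservableFamily.cast_η_liftLogPath_shift_heq {H₃ : Δ.sub3.HomotopyFamily}
    (hH : Δ.IsLogObservableFamily H₃) (m : ℤ) {a : LFVertex} (P Q : Path a LFVertex.third)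
    (c : (Δ.sub3_eq_comapAlong ▸ H₃).E (liftLogPath.{u} P le_rfl) (liftLogPath.{u} Q le_rfl))
    (c' : (Δ.sub3_eq_comapAlong ▸ H₃).E (liftLogPath.{u} ((LFVertex.shift.{u} m).mapPath P) le_rfl)
      (liftLogPath.{u} ((LFVertex.shift.{u} m).mapPath Q) le_rfl)) :
    HEq ((Δ.sub3_eq_comapAlong ▸ H₃).η c') ((Δ.sub3_eq_comapAlong ▸ H₃).η c) := by
  have hh : H₃.E (liftLogPath.{u} P le_rfl) (liftLogPath.{u} Q le_rfl) :=
    (HomotopyFamily.cast_E_iff Δ.sub3_eq_comapAlong H₃ _ _).mp c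
  have hh' := (HomotopyFamily.cast_E_iff Δ.sub3_eq_comapAlong H₃ _ _).mp c'
  have hh₂ : H₃.E ((shiftLog.{u} m).mapPath (liftLogPath.{u} P le_rfl))
      ((shiftLog.{u} m).mapPath (liftLogPath.{u} Q le_rfl)) :=
    (hH.1 _ _).mpr (Δ.saturation_logGen_shiftLog m ((hH.1 _ _).mp hh))
  refine (HomotopyFamily.cast_η_heq Δ.sub3_eq_comapAlong H₃ c').trans
    (HEq.trans ?_ (HomotopyFamily.cast_η_heq Δ.sub3_eq_comapAlong H₃ c).symm)
  exact (H₃.η_heq_of_path_heq (liftLogVertex_shiftObj m a _ _).symm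
    (liftLogPath_shift_heq m P le_rfl le_rfl).symm (liftLogPath_shift_heq m Q le_rfl le_rfl).symm hh₂ hh').trans
    (hH.η_shiftLog_heq m hh hh₂)

/-- **The glued homotopies are invariant under the translation of the first row**: for an `𝔖_log` family `H₃`
and a glued pair `([γ₁],[γ₂])`, `glueη (shift γ₁, shift γ₂) ≍ glueη ([γ₁],[γ₂])` — through `ℰ` on pairs into
rows 4–6 (`coresFamily_η_shift_heq`), through the `𝔖_log` family on pairs into `𝒩`
(`IsLogObservableFamily.η_shiftLog_heq`). [cite: MochizukiAbsTopIII2015, Corollary 3.6 (v) p.80] -/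
theorem glueη_shift_heq {H₃ : Δ.sub3.HomotopyFamily} (hH : Δ.IsLogObservableFamily H₃) (m : ℤ)
    {a b : LFVertex} {P Q : Path a b} (h : Δ.GlueE P Q)
    (h' : Δ.GlueE ((LFVertex.shift.{u} m).mapPath P) ((LFVertex.shift.{u} m).mapPath Q)) :
    HEq (Δ.glueη H₃ hH.1 h') (Δ.glueη H₃ hH.1 h) := by
  rcases b with _ | _ | _ | _ | _ | _
  · exact (Δ.glueE_false_of_row_le_two (by simp [LFVertex.row]) h).elim
  · exact (Δ.glueE_false_of_row_le_two (by simp [LFVertex.row]) h).elim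
  · rcases a with n | _ | _ | _ | _ | _
    · show HEq (Δ.glueηRow1 H₃ hH.1 _ _ _ h') (Δ.glueηRow1 H₃ hH.1 n P Q h)
      unfold glueηRow1 pushLogη
      exact eqToHom_comp_comp_eqToHom_heq_of_heq _ _ _ (eqToHom_comp_comp_eqToHom_heq_of_heq _ _ _
        (HEq.symm (eqToHom_comp_comp_eqToHom_heq_of_heq _ _ _ (eqToHom_comp_comp_eqToHom_heq_of_heq _ _ _
          (HEq.symm (hH.cast_η_liftLogPath_shift_heq m P Q _ _))))))
    · show HEq (Δ.glueηNexus H₃ hH.1 _ _ h') (Δ.glueηNexus H₃ hH.1 P Q h)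
      unfold glueηNexus pushLogη
      exact eqToHom_comp_comp_eqToHom_heq_of_heq _ _ _ (eqToHom_comp_comp_eqToHom_heq_of_heq _ _ _
        (HEq.symm (eqToHom_comp_comp_eqToHom_heq_of_heq _ _ _ (eqToHom_comp_comp_eqToHom_heq_of_heq _ _ _
          (HEq.symm (hH.cast_η_liftLogPath_shift_heq m P Q _ _))))))
    · show HEq (Δ.glueηThird H₃ hH.1 _ _ h') (Δ.glueηThird H₃ hH.1 P Q h)
      unfold glueηThird pushLogη
      exact eqToHom_comp_comp_eqToHom_heq_of_heq _ _ _ (eqToHom_comp_comp_eqToHom_heq_of_heq _ _ _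
        (HEq.symm (eqToHom_comp_comp_eqToHom_heq_of_heq _ _ _ (eqToHom_comp_comp_eqToHom_heq_of_heq _ _ _
          (HEq.symm (hH.cast_η_liftLogPath_shift_heq m P Q _ _))))))
    · exact (false_of_path_to_third (by decide) P).elim
    · exact (false_of_path_to_third (by decide) P).elim
    · exact (false_of_path_to_third (by decide) P).elim
  · exact Δ.coresFamily_η_shift_heq m (Δ.univE_of_glueE (by decide) h)
      (Δ.univE_of_glueE (by intro hc; cases hc) h')
  · exact Δ.coresFamily_η_shift_heq m (Δ.univE_of_glueE (by decide) h)
      (Δ.univE_of_glueE (by intro hc; cases hc) h')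
  · exact Δ.coresFamily_η_shift_heq m (Δ.univE_of_glueE (by decide) h)
      (Δ.univE_of_glueE (by intro hc; cases hc) h')

end LogFrobeniusData

end Literature.AnabelianGeometry.AbsoluteAnabelian
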